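import Mathlib
import HarnessLib
import Literature.Analysis.FluidPDE.TypeIAncientMildClassical
import Literature.Analysis.FluidPDE.ClassicalSolution
import Literature.Analysis.FluidPDE.Vorticity
import Literature.Analysis.FluidPDE.VorticityCalculus
import Summits.NavierStokesRegularity.NavierStokesRegularity.Theorems.PoloidalWindowDoorPoloidalWindowRigidityWindow

/-!
# Route `PoloidalWindowDoor` (staged, nsreg-p1), crux `PoloidalWindowRigidity` — stub `stub_firstIntegral`
# (the FROZEN CONSTRAINT of the poloidal stratum)

Cell ns-regularity-ideate, seat p6 (route-directed support; land `--supports <PoloidalWindowRigidity item>` once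
the route is born — the statement is VERBATIM the registered stub signature, tree vocabulary only).  Port of the
cell's kernel theorem `Cell.NsRegP1c.IsTypeIProfile.stretching_inner_eq_zero` (nsreg-p1 ROUND-8, Sketch8A
L5165): on the poloidal stratum (`⟪curl v(s), e⟫ ≡ 0` at all backward times) the `e`-component of the
vorticity equation `∂ₛ(ω̄·e) + v·∇(ω̄·e) − Δ(ω̄·e) = ω̄·∇(v·e)` has vanishing left-hand side, so the vortex
stretching of the dead component vanishes identically: `⟪Dv(s,y) ω̄(s,y), e⟫ = 0` — the velocity component `v·e`
is a first integral of the vortex lines.  Ingredients: the class lies in `IsTypeIAncientMild`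
(`isTypeIAncientMild_of_class`), which solves Navier–Stokes classically on every window `(t₀,0)` for some
smooth pressure (tree `IsTypeIAncientMild.exists_isClassicalNSSolutionOn_Ioo`, Fabes–Jones–Rivière) and hence
the vorticity equation (tree `IsClassicalNSSolutionOn.isVorticitySolutionOn_zero_force`).

WHAT THIS IS NOT: not a claim about Navier–Stokes regularity; a support lemma for a STAGED door route.
-/

noncomputable section

-- the summit and its single sub-problem share the name (CONVENTIONS §1), as in every Theorems file
set_option linter.dupNamespace false

namespace Summit.NavierStokesRegularity.NavierStokesRegularity.Theorems.PoloidalWindowDoorPoloidalWindowRigidityFirstIntegral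

open MeasureTheory Set Function Filter Topology TopologicalSpace Metric
open scoped Laplacian RealInnerProductSpace InnerProductSpace
open Literature.Analysis Literature.Analysis.FluidPDE
open Summit.NavierStokesRegularity.NavierStokesRegularity.Theorems.PoloidalWindowDoorPoloidalWindowRigidityWindow

/-- **Stub `stub_firstIntegral` of the PoloidalWindowRigidity birth skeleton** (VERBATIM signature): for a
profile of the route's class that is poloidal along `e` (`⟪curl v(s), e⟫ ≡ 0` for all `s < 0`), the
stretching of the dead vorticity component vanishes: `⟪Dv(s,y)(curl v(s,y)), e⟫ = 0` for all `s < 0`, `y`. -/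
theorem stub_firstIntegral :
    ∀ (C : ℝ) (v : ℝ → EuclideanSpace ℝ (Fin 3) → EuclideanSpace ℝ (Fin 3)),
    Literature.Analysis.FluidPDE.HasTypeITimeDecay C v →
    ContinuousOn (Function.uncurry v) (Set.Iio (0 : ℝ) ×ˢ Set.univ) →
    (∀ s t : ℝ, s < t → t < 0 → ∀ x, v t x =
      Literature.Analysis.UnboundedOperators.heatExtension (v s) (t - s) x -
        Literature.Analysis.FluidPDE.oseenDuhamel 1 s v v t x) →
    (∀ t < 0, Literature.Analysis.FluidPDE.VectorCalculus.IsDivFree (v t)) →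
    ∀ (e : EuclideanSpace ℝ (Fin 3)), (∀ s < 0, ∀ y, ⟪Literature.Analysis.FluidPDE.curl (v s) y, e⟫_ℝ = 0) →
    ∀ s < 0, ∀ y, ⟪fderiv ℝ (v s) y (Literature.Analysis.FluidPDE.curl (v s) y), e⟫_ℝ = 0 := by
  intro C v hrate hcont hmild hdiv e hpol s hs y
  have h2s : 2 * s < 0 := by linarith
  have hS : UniqueDiffOn ℝ (Ioo (2 * s) 0) := isOpen_Ioo.uniqueDiffOn
  have hsS : s ∈ Ioo (2 * s) 0 := ⟨by linarith, hs⟩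
  have hV : IsVorticitySolutionOn (Ioo (2 * s) 0) 1 v := by
    obtain ⟨p, hns⟩ :=
      (isTypeIAncientMild_of_class hrate hcont hmild hdiv).exists_isClassicalNSSolutionOn_Ioo h2s
    exact hns.isVorticitySolutionOn_zero_force isOpen_Ioo.uniqueDiffOn
      (by rw [isOpen_Ioo.interior_eq]; exact subset_closure)
  have hω : IsSmoothSpaceTimeOn (Ioo (2 * s) 0) (vorticity v) :=
    hV.smooth_velocity.isSmoothSpaceTimeOn_vorticity hS
  have hv3 : ContDiff ℝ 3 (v s) := contDiff_infty.1 (hV.contDiff_velocity hsS) 3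
  have hc2 : ContDiff ℝ 2 (curl (v s)) := contDiff_curl (n := 2) (by exact_mod_cast hv3)
  -- the functional `L w = ⟪e, w⟫`
  set L : (EuclideanSpace ℝ (Fin 3)) →L[ℝ] ℝ := innerSL ℝ e with hLdef
  have hL : ∀ w : (EuclideanSpace ℝ (Fin 3)), L w = ⟪e, w⟫_ℝ := fun w => by simp only [hLdef, innerSL_apply_apply]
  -- the dead component: `L ∘ ω̄(t) ≡ 0` for `t` in the window
  have hLω : ∀ t ∈ Ioo (2 * s) 0, ∀ x : (EuclideanSpace ℝ (Fin 3)), L (vorticity v t x) = 0 := fun t ht x => by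
    rw [hL, vorticity_apply, real_inner_comm]
    exact hpol t ht.2 x
  have hLc : (⇑L ∘ curl (v s)) = fun _ => (0 : ℝ) := funext fun x => hLω s hsS x
  -- (1) the time derivative of the dead component vanishes
  have h1 : L (timeDerivWithin (Ioo (2 * s) 0) (vorticity v) s y) = 0 := by
    have hc : derivWithin (fun t => L (vorticity v t y)) (Ioo (2 * s) 0) s =
        derivWithin (fun _ : ℝ => (0 : ℝ)) (Ioo (2 * s) 0) s :=
      derivWithin_congr (fun t ht => hLω t ht y) (hLω s hsS y)
    rw [← hω.timeDerivWithin_clm_comp hS L hsS y, timeDerivWithin_apply, hc]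
    simp
  -- (2) the convection of the dead component vanishes
  have h2 : L (convect (v s) (vorticity v s) y) = 0 := by
    have hcomp : HasFDerivAt (⇑L ∘ curl (v s)) (L.comp (fderiv ℝ (curl (v s)) y)) y :=
      L.hasFDerivAt.comp y ((hc2.differentiable (by norm_num)) y).hasFDerivAt
    have h0 : HasFDerivAt (⇑L ∘ curl (v s)) (0 : (EuclideanSpace ℝ (Fin 3)) →L[ℝ] ℝ) y := by
      rw [hLc]; exact hasFDerivAt_const (0 : ℝ) y
    have := congrArg (fun φ : (EuclideanSpace ℝ (Fin 3)) →L[ℝ] ℝ => φ (v s y)) (hcomp.unique h0)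
    simpa [convect] using this
  -- (3) the Laplacian of the dead component vanishes
  have h3 : L ((Δ (vorticity v s)) y) = 0 := by
    have hΔ := ContDiffAt.laplacian_CLM_comp_left (l := L) (hc2.contDiffAt (x := y))
    rw [hLc] at hΔ
    simp only [InnerProductSpace.laplacian_const, Pi.zero_apply, Function.comp_apply] at hΔ
    simpa using hΔ.symm
  -- (4) hence the stretching of the dead component vanishes
  have h4 : L (convect (vorticity v s) (v s) y) = 0 := by
    have heq := congrArg L (hV.vorticity_eq s hsS y)
    rw [map_add, map_add, map_smul, h1, h2, h3, zero_add, smul_zero, add_zero] at heq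
    exact heq.symm
  rw [hL, real_inner_comm] at h4
  simpa [convect] using h4

end Summit.NavierStokesRegularity.NavierStokesRegularity.Theorems.PoloidalWindowDoorPoloidalWindowRigidityFirstIntegral

end
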